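import Literature.MathematicalPhysics.QuantumFieldTheory.Balaban1983to89.B9PinMembersKLevelV1
import Literature.MathematicalPhysics.QuantumFieldTheory.Balaban1983to89.B9BetaRangeKLevelV1
import Literature.MathematicalPhysics.QuantumFieldTheory.Balaban1983to89.B6KLevelFamilyWitnessOddLV1

/-!
# `Balaban1983to89.Node00.MemberYCornered` — THE [B9] MEMBER TYPE `MemberY` CONTAINS CORNERED MEMBERS: at every admissible `(d, L, k ≥ 3, band, M*)`
# there is a member whose carrier-block map `β : (index bonds) → 𝔅` is NOT onto, so the family-level section hypothesis
# `hι : ∀ x s, β (ιB x s) = s` of the Sect.-B chain (`B9SectBGpTransferInY.hin_KSC`, `B9SectBGpFrameCodedY.gpFrame₂Coded`) is satisfied by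
# NO `ιB` at the record

T. Bałaban, *Propagators for lattice gauge theories in a background field*, Commun. Math. Phys. **99** (1985) 389–434
[`Balaban1985BackgroundPropagators`, "B9"]; [4] = T. Bałaban, *Propagators and renormalization transformations for lattice gauge
theories. II*, Commun. Math. Phys. **96** (1984) 223–250 [`Balaban1984PropagatorsII`].

statement-level skeleton of published theorems with citation tags; proofs where landed; nothing here is a claim about the
Yang–Mills mass gap

THE PRINTED LOCI.  [4] (2.1)–(2.4) p. 224: the family ranges over nested sequences `Ω₁ ⊃ Ω₂ ⊃ … ⊃ Ω_k` of unions of big blocks («we admit the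
case when some domains Ω_j are equal to T_η»), `Λ_j = Ω_j^{(j)} ∖ Ω_{j+1}^{(j)}`, `𝔅 = ⋃_j Λ_j`; (2.45) p. 231 + p. 248 («sites replaced by bonds»):
the index bonds and their carrier blocks; [B9] p. 399: the constants depend on `d, L` only — the member type is the whole family.
dag-n06-i's `B9BetaRangeKLevelV1.surjective_beta_iff` (row 25): at a member, `β` is onto `𝔅` iff NO block of `𝔅` is an INNER CORNER (all forward
neighbours one level deeper, all backward neighbours at its own level); its header records «whether a given member HAS an inner corner is not
decided here (the `TDomains` axioms (2.1)–(2.2) allow both)».  THIS FILE DECIDES IT for the member type of record: cornered members exist at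
every parameter value, with `M` beyond every threshold.

WHY THIS FILE (cell `pub-ymgap`, N06 row 13; seat `pub-ymgap-node00-def-Y` gen 15 = the OWNER of the `OpsY` instance at the record; dag-n06-c g7
HANDOFF RISK-1 «`hι : β ∘ ιB = id` exists iff the member is corner-free … settle this FIRST (ask def-Y ∕ n06-k)»; ref-E g13 READ-1∕10∕READ-2:
GAP-STATED(`hι`, FAMILY-LEVEL)).  dag-n06-c's Sect.-B chain reads NODE 00's operators at block labels `ιB : 𝔅 → (index bonds)` that are a SECTION of
`β` (`hι`).  In the letters and readings files (`B9SectBGpLettersY`, `B9SectBGpReadingsY`; `… (hι : ∀ s : BlkY i, β … (ιB s) = s)`) `hι` is PER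
MEMBER — an honest side condition («corner-free members only»).  In the two family-level statements — `B9SectBGpTransferInY.hin_KSC` (l.418) and
`B9SectBGpFrameCodedY.gpFrame₂Coded` (l.208) — it is FAMILY-LEVEL: `hι : ∀ (x : MemberY d ℓ hd hL b₀ b₁ Mstar) (s : BlkY x.toKIdx), β … (ιB x s) = s`.
By §3 below that binder is UNSATISFIABLE whenever the member type is inhabited at all (odd `L ≥ 5`, band `0 < b₀ ≤ b₁`): those two statements are
inhabited over no `ιB` as typed, and RISK-1's quasi-section (labels at bounded distance, adjacent level) — or a restriction of the served member
type to corner-free members, or a per-member `hι` moved under the `∀ x` — is forced, not optional.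
* §1 `exists_corner_TDomains`: for `k = j + 2 ≥ 3` the nested torus family `Ω₁ = … = Ω_j = T_η`, `Ω_{j+1} = T_η ∖ Q`, `Ω_{j+2} = ∅`, `Q` = the
  big `(j+1)`-block of the origin (side `S = M_h·L^{j+2}` fine units): level `j` on `Q` (`blk S x = blk S 0`), `j + 1` off `Q`; (2.1) holds blockwise
  at `j + 1` and trivially elsewhere, (2.2) is void (levels `∈ {j, j+1}`).  THEOREMS ONLY (the member is exhibited inside `∃`, as
  `B6KLevelFamilyWitnessOddLV1.exists_const_TDomains`); no definition, no `def … : Prop`.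
* §2 two unfoldings of `B6GlobalChartV1.domT`: `mem_Om_of_le_lev` (`Ω_j^{(j)} = T^{(j)}` when `lev ≥ j` everywhere) and `deep_of_forall` (`y` is deep
  at level `j` once every fine site over `B(y + ·)`'s `(j+1)`-block has level `≥ j + 1`).
* §3 ★ `kIdx_exists_not_surjective_beta`: at every odd `L ≥ 5` (`4 ≤ ℓ`), `k ≥ 3`, band `0 < b₀ ≤ b₁` and real `M₂`, a k-level V1 member `i : KIdx` in
  print's units (`c_f = Lᵏ`) with `i.k = k`, `M₂ ≤ M` and `¬ Surjective (β i.hN i.D i.hk)` — the V1 parameters of `B9PinMembersKLevelV1.kIdx_topConst_L5`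
  (`M_h = Lᵃ`, `P′ = R = 2L²`, `m = k + a + 3`, `K = 0`, band weights rescaled by `c_f²`) over §1's family; its top level is EMPTY, so every cube is
  placed by `B6KLevelFamilyWitnessOddLV1.placed_of_lev_le` at EVERY odd `L ≥ 5`; the inner corner is the last `j`-block of `Q` in every direction
  (fine labels `(M_hL² − 1)·Lʲ`), fed to dag-n06-i's `B9BetaRangeKLevelV1.not_surjective_beta_of_corner` — `hfwd` by the label arithmetic
  `B5Eq118OneStroke.val_iterBlockOf` ∕ `Site.val_blockOf` (a fine site over the forward neighbour block has label `≥ M_h·L^{j+2}`, i.e. lies off `Q`),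
  `hbwd` by §2.  ★ `memberY_exists_not_surjective_beta`: the same at the [B9] member type `MemberY d ℓ hd hL b₀ b₁ Mstar` (diagonal member, `Λ = ∅`,
  every floor `Mstar`).  ★★ `not_forall_memberY_beta_section`: for EVERY candidate `ιB`, `¬ ∀ x s, β x.hN x.D x.hk (ιB x s) = s` — the negation of
  the binder `hι` of `hin_KSC` ∕ `gpFrame₂Coded` (their `BlkY x.toKIdx` ∕ `IBondY x.toKIdx` are `↥(bset x.D.toDomains)` ∕ `BondIdx (domT x.hN x.D x.hk)`
  reducibly; by-import probe: `example (ιB …) (hι : ∀ x (s : BlkY x.toKIdx), β … (ιB x s) = s) : False := not_forall_memberY_beta_section hℓ hb₀ hb₁ ιB hι`).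

HONEST SCOPE.  Finite combinatorics of [4]'s index sets (2.1)–(2.4), (2.45) on the cell's V1 torus chart; one explicit member is exhibited and
dag-n06-i's corner criterion is applied to it; nothing of [B9]'s or [4]'s analysis is asserted; the per-member files of the Sect.-B chain are not
touched (their `hι` is an honest side condition: it restricts them to corner-free members).  COUNT-NEUTRAL; N06 NOT discharged; NOT summit
progress; one finite 𝕋⁴ programme at fixed ε — nothing continuum, nothing about the mass gap.  Cell `pub-ymgap` (HUMAN RULING D-0062), Track A
node N06 [B9], seat `pub-ymgap-node00-def-Y` (g15), 2026-08-27.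
-/

noncomputable section

namespace Literature.MathematicalPhysics.QuantumFieldTheory.Balaban1983to89.Node00.MemberYCornered

open B4Reflection242 (boxDom blk)
open B5Eq118OneStroke (iterBlockOf iterBlockOf_succ val_iterBlockOf)
open B6MultiLevelBoxOperator (bigSide N0)
open B6MultiLevelTorusOperator (TDomains)
open B6SectAOperatorsV1 (BondIdx)
open B6CubeWindowV1 (Placed GlobalBand)
open B6Cover236MultiLevelBlocks (cubes)
open B6KLevelCensusIndexV1 (KIdx kGeo)
open B6GlobalChartV1 (PV toBox toBox_apply domT)
open B6Geom246MultiLevelBox (bset)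
open B6Ineq2142KLevelV1 (β)
open B6KLevelFamilyWitnessOddLV1 (placed_of_lev_le)
open B6KLevelFamilyWitnessV1 (N0_V1_pow globalBand_witness exists_exponent)
open B9PinMembersKLevelV1 (MemberY geo9Y)
open B9BetaRangeKLevelV1 (not_surjective_beta_of_corner)

variable {d : ℕ}

/-! ## §1 The two-level family with an inner corner: `Ω_{j+1} = T_η ∖ Q` -/

/-- bookkeeping on the two-valued level function `j ∕ j + 1`: `j ≤ lev`. [cite: Balaban1984PropagatorsII, (2.1)–(2.4) p.224, bookkeeping] -/
private theorem le_ite_lev {p : Prop} [Decidable p] {j : ℕ} : j ≤ (if p then j else j + 1) := by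
  split_ifs <;> omega

/-- `lev ≤ j + 1` (the nominal top level `j + 2` is EMPTY). [cite: Balaban1984PropagatorsII, (2.1)–(2.4) p.224, bookkeeping] -/
private theorem ite_lev_le {p : Prop} [Decidable p] {j : ℕ} : (if p then j else j + 1) ≤ j + 1 := by
  split_ifs <;> omega

/-- `j + 1 ≤ lev ↔` off `Q`. [cite: Balaban1984PropagatorsII, (2.1)–(2.4) p.224, bookkeeping] -/
private theorem succ_le_ite_lev_iff {p : Prop} [Decidable p] {j : ℕ} : j + 1 ≤ (if p then j else j + 1) ↔ ¬ p := by
  split_ifs with h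
  · simp only [h, not_true_eq_false, iff_false, not_le]; omega
  · simp only [le_refl, h, not_false_eq_true]

/-- **THE CORNERED TWO-LEVEL MEMBER ON EVERY TORUS** (`k = j + 2 ≥ 3`): `Ω₁ = … = Ω_j = T_η`, `Ω_{j+1} = T_η ∖ Q`, `Ω_{j+2} = ∅` with `Q` the big
`(j+1)`-block of the origin (side `S = M_h·L^{j+2}` fine units; `x ∈ Q ↔ blk S x = blk S 0` on the fundamental box) — level `j` on `Q`, `j + 1` off `Q`.
(2.1): membership in `Ω_{j+1}` depends on the big `(j+1)`-block only, the other levels are trivial; (2.2): void, the levels lying in `{j, j+1}`.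
[cite: Balaban1984PropagatorsII, (2.1)–(2.2) p.224 («we admit the case when some domains Ω_j are equal to T_η»)] -/
theorem exists_corner_TDomains (d ℓ Mh j : ℕ) (P : Fin (d + 1) → ℕ) (R : ℕ) (hj : 1 ≤ j) :
    ∃ D : TDomains d ℓ Mh (j + 2) P R,
      ∀ x, D.lev x = if blk (bigSide ℓ Mh (j + 1)) x = blk (bigSide ℓ Mh (j + 1)) 0 then j else j + 1 := by
  classical
  refine ⟨{ lev := fun x => if blk (bigSide ℓ Mh (j + 1)) x = blk (bigSide ℓ Mh (j + 1)) 0 then j else j + 1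
            one_le_lev := fun x => hj.trans le_ite_lev
            lev_le := fun x => ite_lev_le.trans (Nat.le_succ _)
            bigBlocks := fun i hi x _ x' _ hblk => ?_
            sepT := fun i x _ x' _ h1 h2 => ?_ }, fun _ => rfl⟩
  · rcases Nat.lt_or_ge i (j + 1) with h | h
    · exact ⟨fun _ => le_trans (by omega) le_ite_lev, fun _ => le_trans (by omega) le_ite_lev⟩
    · rcases h.eq_or_lt with h | h
      · subst h
        rw [succ_le_ite_lev_iff, succ_le_ite_lev_iff, hblk]
      · constructor
        · intro h'; exfalso
          have := (ite_lev_le : (if blk (bigSide ℓ Mh (j + 1)) x = blk (bigSide ℓ Mh (j + 1)) 0 then j else j + 1) ≤ j + 1)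
          omega
        · intro h'; exfalso
          have := (ite_lev_le : (if blk (bigSide ℓ Mh (j + 1)) x' = blk (bigSide ℓ Mh (j + 1)) 0 then j else j + 1) ≤ j + 1)
          omega
  · exfalso
    have := (le_ite_lev : j ≤ if blk (bigSide ℓ Mh (j + 1)) x = blk (bigSide ℓ Mh (j + 1)) 0 then j else j + 1)
    have := (ite_lev_le : (if blk (bigSide ℓ Mh (j + 1)) x' = blk (bigSide ℓ Mh (j + 1)) 0 then j else j + 1) ≤ j + 1)
    omega

/-! ## §2 Two unfoldings of the V1 domain datum `domT` -/

section DomT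

variable {ℓ m K : ℕ} {hd : 1 ≤ d + 1} {hL : Odd (ℓ + 1) ∧ 1 < ℓ + 1} {Mh k R : ℕ} {P' : Fin (d + 1) → ℕ}
variable (hN : ∀ μ, N0 ℓ Mh k P' μ = (PV d ℓ m K hd hL).sitesPerDir 0) (D : TDomains d ℓ Mh k P' R) (hk : k ≤ m + K)

/-- `Ω_j^{(j)} = T^{(j)}` when every site has level `≥ j` (`1 ≤ j ≤ k`). [cite: Balaban1984PropagatorsII, (2.1)–(2.4) p.224 («Ω_j = T_η for j = 1, 2, …»)] -/
theorem mem_Om_of_le_lev {j : ℕ} (hj1 : 1 ≤ j) (hjk : j ≤ k) (hlev : ∀ z, j ≤ D.lev z) (y : Site (PV d ℓ m K hd hL) j) :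
    y ∈ (domT hN D hk).Om j := by
  classical
  have hj0 : j ≠ 0 := by omega
  simp only [domT, hj0, if_false, hjk, if_true, Finset.mem_filter, Finset.mem_univ, true_and]
  intro x _
  exact hlev _

/-- `y ∈ Ω_{j+1}^{(j)}` (deep at level `j`) once every fine site whose `(j+1)`-block point is `B(y)`'s has level `≥ j + 1` (`j + 1 ≤ k`).
[cite: Balaban1984PropagatorsII, (2.3) p.224] -/
theorem deep_of_forall {j : ℕ} (hjk : j + 1 ≤ k) (y : Site (PV d ℓ m K hd hL) j)
    (h : ∀ x : Site (PV d ℓ m K hd hL) 0, iterBlockOf (j + 1) x = blockOf y → j + 1 ≤ D.lev (toBox hN x : Fin (d + 1) → ℤ)) :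
    (domT hN D hk).Deep j y := by
  classical
  show blockOf y ∈ (domT hN D hk).Om (j + 1)
  have hj0 : j + 1 ≠ 0 := by omega
  simp only [domT, hj0, if_false, hjk, if_true, Finset.mem_filter, Finset.mem_univ, true_and]
  exact h

end DomT

/-! ## §3 Cornered members of `KIdx` and of `MemberY`; the family-level section hypothesis fails -/

section Members

variable {ℓ : ℕ} {hd : 1 ≤ d + 1} {hL : Odd (ℓ + 1) ∧ 1 < ℓ + 1} {b₀ b₁ : ℝ} {Mstar : ℕ}

/-- the site count of the V1 torus at scale `i`: `2·L^{m+K−i}`. [cite: Balaban1984PropagatorsII, (2.1) p.224, dictionary] -/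
theorem sitesPerDir_PV (m K i : ℕ) : (PV d ℓ m K hd hL).sitesPerDir i = 2 * (ℓ + 1) ^ (m + K - i) := rfl

/-- ★ **A CORNERED k-LEVEL MEMBER AT EVERY ODD `L ≥ 5`, `k ≥ 3`, WITH `M` BEYOND EVERY THRESHOLD**: a V1 member `i : KIdx` in print's units with
`i.k = k`, `M₂ ≤ M = L·M_h`, whose carrier-block map `β` is NOT onto `𝔅` (§1's family: the last `(k−2)`-block of `Q` in every direction is an inner
corner). [cite: Balaban1984PropagatorsII, (2.1)–(2.4) p.224, (2.16) p.225, (2.45) p.231; Balaban1985BackgroundPropagators, p.399 (the family)] -/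
theorem kIdx_exists_not_surjective_beta (hℓ : 4 ≤ ℓ) {k : ℕ} (hk : 3 ≤ k) (hb₀ : 0 < b₀) (hb₁ : b₀ ≤ b₁) (M₂ : ℝ) :
    ∃ i : KIdx d ℓ hd hL b₀ b₁, i.k = k ∧ i.cf = (((ℓ + 1 : ℕ) : ℝ)) ^ i.k ∧ M₂ ≤ (kGeo i).M ∧
      ¬ Function.Surjective (β i.hN i.D i.hk) := by
  obtain ⟨j, rfl⟩ : ∃ j, k = j + 2 := ⟨k - 2, by omega⟩
  have hj : 1 ≤ j := by omega
  have hLpos : 0 < ℓ + 1 := Nat.succ_pos ℓ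
  obtain ⟨a, h8, hM₂, -⟩ := exists_exponent ℓ (by omega) M₂ 0 (2 * (ℓ + 1) ^ 2) (by nlinarith)
  set P' : Fin (d + 1) → ℕ := fun _ => 2 * (ℓ + 1) ^ 2 with hP'
  have hP5 : ∀ μ : Fin (d + 1), 5 ≤ P' μ := fun μ => by simp only [hP']; nlinarith
  have hN : ∀ μ, N0 ℓ ((ℓ + 1) ^ a) (j + 2) P' μ = (PV d ℓ (j + 2 + a + 3) 0 hd hL).sitesPerDir 0 :=
    fun μ => N0_V1_pow ℓ (j + 2) a 2 (j + 2 + a + 3) 0 hd hL (by ring) μ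
  have hk' : j + 2 ≤ j + 2 + a + 3 + 0 := by omega
  -- the family and its V1 accessories
  obtain ⟨D, hDlev⟩ := exists_corner_TDomains d ℓ ((ℓ + 1) ^ a) j P' (2 * (ℓ + 1) ^ 2) hj
  have hlevle : ∀ z, D.lev z ≤ j + 1 := fun z => by rw [hDlev]; exact ite_lev_le
  have hlevge : ∀ z, j ≤ D.lev z := fun z => by rw [hDlev]; exact le_ite_lev
  have hpl : ∀ c : ↥(cubes D.toDomains), Placed ℓ (j + 2) P' c.1 :=
    placed_of_lev_le D.toDomains hP5 (j := j + 1) (by omega) hlevle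
  obtain ⟨w, hw, hwb⟩ := globalBand_witness (domT hN D hk') hb₀ hb₁
  set cf : ℝ := (((ℓ + 1 : ℕ) : ℝ)) ^ (j + 2) with hcfdef
  have hcf : cf ≠ 0 := by positivity
  have hwb' : GlobalBand b₀ b₁ cf (fun i => cf ^ 2 * w i) := by
    intro i
    obtain ⟨h1, h2⟩ := hwb i
    have key : cf ^ 2 * w i / (cf / (((ℓ + 1 : ℕ) : ℝ)) ^ (i.1.1 : ℕ)) ^ 2 = w i / (1 / (((ℓ + 1 : ℕ) : ℝ)) ^ (i.1.1 : ℕ)) ^ 2 := by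
      field_simp
    dsimp only
    rw [key]
    exact ⟨h1, h2⟩
  refine ⟨⟨j + 2 + a + 3, 0, (ℓ + 1) ^ a, j + 2, 2 * (ℓ + 1) ^ 2, a, P', hN, D, hk', by omega, rfl, h8, le_rfl, hP5, hℓ, hpl,
    cf, hcf, fun i => cf ^ 2 * w i, fun i => mul_pos (by positivity) (hw i), hwb'⟩, rfl, rfl, ?_, ?_⟩
  · show M₂ ≤ (((ℓ + 1 : ℕ) : ℝ)) * ((((ℓ + 1) ^ a : ℕ)) : ℝ)
    have hcast : (((ℓ + 1 : ℕ) : ℝ)) = (ℓ : ℝ) + 1 := by push_cast; ring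
    rw [hcast]
    exact hM₂
  -- ### the inner corner
  -- `A·Lʲ = S` (the side of `Q`), `A = M_h·L² = A' + 1`
  obtain ⟨A', hA'⟩ : ∃ A', (ℓ + 1) ^ a * (ℓ + 1) * (ℓ + 1) = A' + 1 := by
    have h0 : 0 < (ℓ + 1) ^ a * (ℓ + 1) * (ℓ + 1) := by positivity
    exact ⟨(ℓ + 1) ^ a * (ℓ + 1) * (ℓ + 1) - 1, by omega⟩
  have hpowj : 0 < (ℓ + 1) ^ j := pow_pos hLpos j
  have hS : bigSide ℓ ((ℓ + 1) ^ a) (j + 1) = A' * (ℓ + 1) ^ j + (ℓ + 1) ^ j := by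
    unfold bigSide; rw [show (ℓ + 1) ^ a * (ℓ + 1) ^ (j + 1 + 1) = ((ℓ + 1) ^ a * (ℓ + 1) * (ℓ + 1)) * (ℓ + 1) ^ j by ring, hA']; ring
  have hApow : A' + 1 = (ℓ + 1) ^ (a + 2) := by rw [← hA']; ring
  -- sizes of the tori involved
  have hm0 : (PV d ℓ (j + 2 + a + 3) 0 hd hL).sitesPerDir 0 = 2 * (ℓ + 1) ^ (j + a + 5) := by
    rw [sitesPerDir_PV]; congr 2; omega
  have hmj : (PV d ℓ (j + 2 + a + 3) 0 hd hL).sitesPerDir j = 2 * (ℓ + 1) ^ (a + 5) := by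
    rw [sitesPerDir_PV]; congr 2; omega
  -- the fine corner site: all labels `A'·Lʲ`
  set x₀ : Site (PV d ℓ (j + 2 + a + 3) 0 hd hL) 0 :=
    fun _ => (((A' * (ℓ + 1) ^ j : ℕ)) : ZMod ((PV d ℓ (j + 2 + a + 3) 0 hd hL).sitesPerDir 0)) with hx₀def
  have hx₀lt : A' * (ℓ + 1) ^ j < (PV d ℓ (j + 2 + a + 3) 0 hd hL).sitesPerDir 0 := by
    rw [hm0]
    calc A' * (ℓ + 1) ^ j < (A' + 1) * (ℓ + 1) ^ j := Nat.mul_lt_mul_of_pos_right (Nat.lt_succ_self _) hpowj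
      _ = (ℓ + 1) ^ (j + a + 2) := by rw [hApow, ← pow_add]; congr 1; omega
      _ ≤ (ℓ + 1) ^ (j + a + 5) := Nat.pow_le_pow_right hLpos (by omega)
      _ ≤ 2 * (ℓ + 1) ^ (j + a + 5) := Nat.le_mul_of_pos_left _ (by norm_num)
  have hx₀val : ∀ μ, (x₀ μ).val = A' * (ℓ + 1) ^ j := fun μ => by
    simp only [hx₀def, ZMod.val_natCast, Nat.mod_eq_of_lt hx₀lt]
  -- `x₀ ∈ Q`: its level is `j`
  have hblk0 : blk (bigSide ℓ ((ℓ + 1) ^ a) (j + 1)) (toBox hN x₀ : Fin (d + 1) → ℤ) = blk (bigSide ℓ ((ℓ + 1) ^ a) (j + 1)) 0 := by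
    funext μ
    simp only [blk, toBox_apply, hx₀val, Pi.zero_apply, Int.zero_ediv]
    apply Int.ediv_eq_zero_of_lt (by positivity)
    rw [hS]; push_cast; linarith [(by exact_mod_cast hpowj : (0 : ℤ) < (((ℓ + 1) ^ j : ℕ) : ℤ))]
  have hlev0 : D.lev (toBox hN x₀ : Fin (d + 1) → ℤ) = j := by rw [hDlev, if_pos hblk0]
  -- the `j`-block point `y = yʲ(x₀)`: labels `A'`
  have hjm : j ≤ (PV d ℓ (j + 2 + a + 3) 0 hd hL).m + (PV d ℓ (j + 2 + a + 3) 0 hd hL).K := by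
    show j ≤ j + 2 + a + 3 + 0; omega
  have hjm1 : j + 1 ≤ (PV d ℓ (j + 2 + a + 3) 0 hd hL).m + (PV d ℓ (j + 2 + a + 3) 0 hd hL).K := by
    show j + 1 ≤ j + 2 + a + 3 + 0; omega
  have hPL : (PV d ℓ (j + 2 + a + 3) 0 hd hL).L = ℓ + 1 := rfl
  have hyval : ∀ μ, ((iterBlockOf j x₀) μ).val = A' := fun μ => by
    rw [val_iterBlockOf j hjm x₀ μ, hx₀val μ, hPL, Nat.mul_div_cancel _ hpowj]
  refine not_surjective_beta_of_corner hN D hk' (by omega) x₀ ?_ ?_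
  · -- forward neighbours: deep at level `j`
    rw [hlev0]
    intro μ
    refine deep_of_forall hN D hk' (by omega) _ fun x hx => ?_
    -- the `μ`-label of `B(y + e_μ)` is `(A' + 1)/L = M_h·L`
    have hsh : (((iterBlockOf j x₀).shift μ) μ).val = A' + 1 := by
      have hlt : ((iterBlockOf j x₀) μ).val + (1 : ZMod ((PV d ℓ (j + 2 + a + 3) 0 hd hL).sitesPerDir j)).val <
          (PV d ℓ (j + 2 + a + 3) 0 hd hL).sitesPerDir j := by
        rw [ZMod.val_one, hyval, hmj, hApow]
        calc (ℓ + 1) ^ (a + 2) ≤ (ℓ + 1) ^ (a + 5) := Nat.pow_le_pow_right hLpos (by omega)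
          _ < 2 * (ℓ + 1) ^ (a + 5) := by have := pow_pos hLpos (a + 5); omega
      simp only [Site.shift, Function.update_self]
      rw [ZMod.val_add_of_lt hlt, ZMod.val_one, hyval]
    have hbl : ((blockOf ((iterBlockOf j x₀).shift μ)) μ).val = (ℓ + 1) ^ a * (ℓ + 1) := by
      rw [Site.val_blockOf hjm1, hsh, hPL, ← hA', Nat.mul_div_cancel _ hLpos]
    -- hence the fine site `x` over that block has `μ`-label `≥ M_h·L·L^{j+1} = S`: it lies off `Q`
    have hxμ : ((x μ).val : ℕ) / (ℓ + 1) ^ (j + 1) = (ℓ + 1) ^ a * (ℓ + 1) := by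
      have := congrArg (fun z : Site (PV d ℓ (j + 2 + a + 3) 0 hd hL) (j + 1) => (z μ).val) hx
      simpa only [val_iterBlockOf (j + 1) hjm1 x μ, hbl, hPL] using this
    have hge : bigSide ℓ ((ℓ + 1) ^ a) (j + 1) ≤ (x μ).val := by
      have h := Nat.div_mul_le_self (x μ).val ((ℓ + 1) ^ (j + 1))
      rw [hxμ] at h
      unfold bigSide
      calc (ℓ + 1) ^ a * (ℓ + 1) ^ (j + 1 + 1) = (ℓ + 1) ^ a * (ℓ + 1) * (ℓ + 1) ^ (j + 1) := by ring
        _ ≤ (x μ).val := h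
    rw [hDlev, succ_le_ite_lev_iff]
    intro hq
    have hqμ := congrFun hq μ
    simp only [blk, toBox_apply, Pi.zero_apply, Int.zero_ediv] at hqμ
    have hSpos : (0 : ℤ) < (bigSide ℓ ((ℓ + 1) ^ a) (j + 1) : ℤ) := by
      have := B6MultiLevelBoxOperator.one_le_bigSide (ℓ := ℓ) (Nat.one_le_pow _ _ hLpos : 1 ≤ (ℓ + 1) ^ a) (j + 1)
      exact_mod_cast this
    have h1 : (1 : ℤ) ≤ ((x μ).val : ℤ) / (bigSide ℓ ((ℓ + 1) ^ a) (j + 1) : ℤ) :=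
      Int.le_ediv_of_mul_le hSpos (by rw [one_mul]; exact_mod_cast hge)
    rw [hqμ] at h1
    exact absurd h1 (by norm_num)
  · -- backward neighbours: in `Ω_j^{(j)} = T^{(j)}`
    rw [hlev0]
    intro μ
    exact mem_Om_of_le_lev hN D hk' hj (by omega) hlevge _

/-- ★ **THE [B9] MEMBER TYPE CONTAINS CORNERED MEMBERS, WITH `M` BEYOND EVERY THRESHOLD**: at every odd `L ≥ 5` (`4 ≤ ℓ`), `k ≥ 3`, band
`0 < b₀ ≤ b₁`, floor `Mstar` and real `M₂`, a member `x : MemberY` with `x.k = k`, `M₂ ≤ (geo9Y x).M` and `¬ Surjective (β x.hN x.D x.hk)` (the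
diagonal member over `kIdx_exists_not_surjective_beta`, `Λ = ∅`). [cite: Balaban1985BackgroundPropagators, p.399 (the family: «(torus, k, {Ω_j}, M) for fixed d, L»); Balaban1984PropagatorsII, (2.1)–(2.4) p.224, (2.45) p.231] -/
theorem memberY_exists_not_surjective_beta (hℓ : 4 ≤ ℓ) {k : ℕ} (hk : 3 ≤ k) (hb₀ : 0 < b₀) (hb₁ : b₀ ≤ b₁) (M₂ : ℝ) :
    ∃ x : MemberY d ℓ hd hL b₀ b₁ Mstar, x.k = k ∧ M₂ ≤ (geo9Y x).M ∧ ¬ Function.Surjective (β x.hN x.D x.hk) := by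
  obtain ⟨i, hik, hcf, hM, hβ⟩ :=
    kIdx_exists_not_surjective_beta (d := d) (hd := hd) (hL := hL) hℓ hk hb₀ hb₁ (max M₂ (Mstar : ℝ))
  have hMstar : Mstar ≤ (ℓ + 1) * i.Mh := by
    have h : (Mstar : ℝ) ≤ ((ℓ + 1 : ℕ) : ℝ) * (i.Mh : ℝ) := (le_max_right _ _).trans hM
    exact_mod_cast h
  exact ⟨MemberY.diag i hcf hMstar, hik, (le_max_left _ _).trans hM, hβ⟩

/-- ★★ **THE FAMILY-LEVEL SECTION HYPOTHESIS FAILS FOR EVERY CANDIDATE**: whenever the member type is served at all (odd `L ≥ 5`, band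
`0 < b₀ ≤ b₁`; any `d`, any floor `Mstar`), NO assignment `ιB` of an index bond to every block of every member is a section of `β` at every member —
the binder `hι : ∀ (x : MemberY …) (s : BlkY x.toKIdx), β … (ιB x s) = s` of `B9SectBGpTransferInY.hin_KSC` and `B9SectBGpFrameCodedY.gpFrame₂Coded`
is unsatisfiable (the per-member `hι` of the Sect.-B letters∕readings files is an honest side condition: corner-free members only).
[cite: Balaban1984PropagatorsII, (2.45) p.231 + p.248 («sites replaced by bonds»); Balaban1985BackgroundPropagators, p.399 (the family)] -/
theorem not_forall_memberY_beta_section (hℓ : 4 ≤ ℓ) (hb₀ : 0 < b₀) (hb₁ : b₀ ≤ b₁)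
    (ιB : (x : MemberY d ℓ hd hL b₀ b₁ Mstar) → ↥(bset x.D.toDomains) → BondIdx (domT x.hN x.D x.hk)) :
    ¬ ∀ (x : MemberY d ℓ hd hL b₀ b₁ Mstar) (s : ↥(bset x.D.toDomains)), β x.hN x.D x.hk (ιB x s) = s := by
  intro h
  obtain ⟨x, -, -, hβ⟩ :=
    memberY_exists_not_surjective_beta (d := d) (hd := hd) (hL := hL) (Mstar := Mstar) hℓ (le_refl 3) hb₀ hb₁ 0
  exact hβ fun s => ⟨ιB x s, h x s⟩

end Members

end Literature.MathematicalPhysics.QuantumFieldTheory.Balaban1983to89.Node00.MemberYCornered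

end
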